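import Summits.NavierStokesRegularity.NavierStokesRegularity.Theorems.PerpetualPumpThesisBilinearOperator
import Summits.NavierStokesRegularity.NavierStokesRegularity.Theorems.PerpetualPumpThesisLocalExistence
import Summits.NavierStokesRegularity.NavierStokesRegularity.Theorems.PerpetualPumpThesisUniqueness
import Summits.NavierStokesRegularity.NavierStokesRegularity.Theorems.PerpetualPumpThesisRestart
import Summits.NavierStokesRegularity.NavierStokesRegularity.Theorems.PerpetualPumpThesisBesovFloorBoundReduction
import Summits.NavierStokesRegularity.NavierStokesRegularity.Theorems.PerpetualPumpThesisBesovDuhamelBound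
import Summits.NavierStokesRegularity.NavierStokesRegularity.Theorems.PerpetualPumpThesisTameDuhamelBound

/-!
# Line `SketchIdeator2` for `PerpetualPump.Thesis`: the `H¹⁰` local theory assembled, and the
# ABSTRACT LERAY FLOOR IN THE BESOV ENVELOPE (card `besov-envelope-floor`, K3) as a theorem

Support file (crux stmt-NavierStokesRegularity-1832, line `SketchIdeator2`; lead's assembly). Every
registered stub of the perturbative half of the line has landed:
`stub_bilinearOperator` (`B̃` as an `H⁹`-valued real divergence-free bilinear operator with the tame
one-derivative-loss bound, Riesz + the weighted trilinear estimate), `stub_localExistence` (Picard in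
`C([0,τ]; H¹⁰_df)` with lifespan uniform on `H¹⁰`-balls), `stub_uniqueness`, `stub_restart`,
`stub_besovDuhamelBound` (the a-priori `Ḃ⁰_{∞,1}` Duhamel bound), `stub_tameDuhamelBound` (`H¹⁰`
persistence under envelope control, Kato–Ponce-type tame estimate) and the reduction
`stub_besovFloorBound_Reduction`. This file records the three consequences the route uses, for an
ARBITRARY averaging datum `𝒜` of Tao (J. Amer. Math. Soc. 29 (2016), (1.12)–(1.13); no symmetry, no
cancellation):

* `stub_thesis_LocalExistenceH10` — **local existence of `H¹⁰_df`-mild solutions from `H¹⁰_df` data**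
  (the theory Tao asserts after (1.15) as "standard"; it is the standing hypothesis `LocalExistenceFor`
  of `Cruxes/Thesis/Disproof.lean` §3c/§4a, up to the membership `schwartzL2 u₀ ∈ H¹⁰_df` of Schwartz
  divergence-free data);
* `stub_thesis_H10Continuation` — **the `H¹⁰` continuation criterion**: an `H¹⁰_df`-mild solution on
  `[0,T)` from a Schwartz divergence-free datum whose `H¹⁰` norm stays bounded extends as a mild solution
  past `T` (restart at `T - τ/2` with the uniform lifespan, glue, identify by uniqueness);
* `stub_thesis_AbstractLerayFloor` — **the abstract Leray floor in the Besov envelope**: there is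
  `ε(𝒜) > 0` such that an `H¹⁰_df`-mild solution from a Schwartz divergence-free datum whose envelope
  amplitude `√(T-t₀) ‖u(t₀)‖_{Ḃ⁰_{∞,1}}` is `≤ ε` at ONE time `t₀ < T` extends as a mild solution past
  `T` — the planner's `AbstractLerayFloor` (idea card `besov-envelope-floor`, K3), i.e. the `L^∞`-scaling
  local theory of the averaged class restored in the multiplier-stable envelope `Ḃ⁰_{∞,1}`. With it the
  crux `Thesis` is EXACTLY `EnvelopeUpgrade ∧ NoPersistentFront` (skeleton `Thesis_of`; tightness in
  `PerpetualPumpThesisEnvelopeTightness.lean`).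

## References

* T. Tao, *Finite time blowup for an averaged three-dimensional Navier–Stokes equation*, J. Amer.
  Math. Soc. 29 (2016), 601–674, arXiv:1402.0290v3, §1.1 (1.12)–(1.15). [Tao2016AveragedNS]
* H. Bahouri, J.-Y. Chemin, R. Danchin, *Fourier Analysis and Nonlinear PDE* (2011), Ch. 2 (`Ḃ⁰_{∞,1}`).
-/

noncomputable section

open MeasureTheory Set Filter Topology
open scoped ENNReal NNReal SchwartzMap

set_option linter.dupNamespace false

namespace Summit.NavierStokesRegularity.NavierStokesRegularity.Theorems.PerpetualPumpThesis.Floor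

open Literature.Analysis.FluidPDE Literature.Analysis.FluidPDE.Tao2016
open Literature.Analysis.FunctionSpaces

/-- **Local existence from `H¹⁰_df` data with lifespan uniform on `H¹⁰`-balls** (B + E): for every
averaging datum and every `R ≥ 0` there is `τ > 0` such that every `a ∈ H¹⁰_df` with `‖a‖_{H¹⁰} ≤ R` is
the datum of an `H¹⁰_df`-mild solution on `[0,τ]` bounded by `2R+1` in `H¹⁰`. -/
theorem exists_uniform_lifespan (𝒜 : AveragingDatum) {R : ℝ} (hR : 0 ≤ R) :
    ∃ τ : ℝ, 0 < τ ∧ ∀ a : L2C, MemH10df a → eFourierSobolevNorm 10 a ≤ ENNReal.ofReal R →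
      ∃ u : ℝ → L2C, IsMildSolutionFor 𝒜.form a (Icc 0 τ) u ∧
        ∀ t ∈ Icc 0 τ, eFourierSobolevNorm 10 (u t) ≤ ENNReal.ofReal (2 * R + 1) := by
  obtain ⟨Bop, K, h0, h1, h2, h3⟩ := stub_bilinearOperator 𝒜
  exact stub_localExistence 𝒜 Bop K ⟨h0, h1, h2, h3⟩ R hR

/-- **The `H¹⁰` continuation criterion, datum-class form** (B + E + U + G): an `H¹⁰_df`-mild solution
on `[0,T)`, `T > 0`, from any datum class `a`, whose `H¹⁰` norm is bounded by `C` on `[0,T)`, extends to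
a mild solution on a strictly longer `[0,T')` agreeing with it on `[0,T)`. -/
theorem extends_of_H10_bounded (𝒜 : AveragingDatum) {a : L2C} {T : ℝ} (hT : 0 < T) {u : ℝ → L2C}
    (hu : IsMildSolutionFor 𝒜.form a (Ico 0 T) u) {C : ℝ}
    (hC : ∀ t ∈ Ico 0 T, eFourierSobolevNorm 10 (u t) ≤ ENNReal.ofReal C) :
    ∃ T' : ℝ, T < T' ∧ ∃ v : ℝ → L2C,
      IsMildSolutionFor 𝒜.form a (Ico 0 T') v ∧ ∀ t ∈ Ico 0 T, v t = u t := by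
  obtain ⟨τ, hτ, hloc⟩ := exists_uniform_lifespan 𝒜 (le_max_right C 0)
  set t₁ : ℝ := max 0 (T - τ / 2) with ht₁_def
  have ht₁0 : 0 ≤ t₁ := le_max_left _ _
  have ht₁T : t₁ < T := max_lt hT (by linarith)
  have hmem : MemH10df (u t₁) := hu.1 t₁ ⟨ht₁0, ht₁T⟩
  have hnorm : eFourierSobolevNorm 10 (u t₁) ≤ ENNReal.ofReal (max C 0) :=
    (hC t₁ ⟨ht₁0, ht₁T⟩).trans (ENNReal.ofReal_le_ofReal (le_max_left _ _))
  obtain ⟨v, hv, -⟩ := hloc (u t₁) hmem hnorm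
  have hglue := stub_restart 𝒜 a T t₁ τ u v ht₁0 ht₁T hτ hu hv
  have hT' : T < t₁ + τ := by
    have : T - τ / 2 ≤ t₁ := le_max_right _ _
    linarith
  refine ⟨t₁ + τ, hT', fun t => if t ≤ t₁ then u t else v (t - t₁), hglue, fun t ht => ?_⟩
  exact (stub_uniqueness 𝒜 a T u _ hu (hglue.mono (Ico_subset_Ico_right hT'.le)) t ht).symm

end Summit.NavierStokesRegularity.NavierStokesRegularity.Theorems.PerpetualPumpThesis.Floor

namespace Summit.NavierStokesRegularity.NavierStokesRegularity.Theorems.PerpetualPumpThesis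

open Literature.Analysis.FluidPDE Literature.Analysis.FluidPDE.Tao2016
open Literature.Analysis.FunctionSpaces

/-- **Local existence of `H¹⁰_df`-mild solutions of the averaged Navier–Stokes equation
`∂ₜu = Δu + B̃(u,u)` from `H¹⁰_df` data, for EVERY averaging datum** (Tao 2016, remark after (1.15):
"the local existence theory is standard"): every `a ∈ H¹⁰_df` is the datum of an `H¹⁰_df`-mild solution
on some `[0,T)`, `T > 0`. -/
theorem stub_thesis_LocalExistenceH10 : ∀ 𝒜 : AveragingDatum, ∀ a : L2C, MemH10df a → ∃ T : ℝ, 0 < T ∧ ∃ u : ℝ → L2C, IsMildSolutionFor 𝒜.form a (Ico 0 T) u := by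
  intro 𝒜 a ha
  have hfin : eFourierSobolevNorm 10 a < ∞ := ha.1
  obtain ⟨τ, hτ, hloc⟩ := Floor.exists_uniform_lifespan 𝒜 (R := (eFourierSobolevNorm 10 a).toReal)
    ENNReal.toReal_nonneg
  obtain ⟨u, hu, -⟩ := hloc a ha (ENNReal.ofReal_toReal hfin.ne).ge
  exact ⟨τ, hτ, u, hu.mono Ico_subset_Icc_self⟩

/-- **The `H¹⁰` continuation criterion for the averaged Navier–Stokes equation, for EVERY averaging
datum**: an `H¹⁰_df`-mild solution on `[0,T)` from a Schwartz divergence-free datum whose `H¹⁰` norm stays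
bounded on `[0,T)` extends as a mild solution past `T` (agreeing with it on `[0,T)`). Existence with
lifespan uniform on `H¹⁰`-balls, restart at `T - τ/2`, semigroup gluing, uniqueness. -/
theorem stub_thesis_H10Continuation : ∀ 𝒜 : AveragingDatum, ∀ u₀ : 𝓢(EuclideanSpace ℝ (Fin 3), EuclideanSpace ℝ (Fin 3)), VectorCalculus.IsDivFree ⇑u₀ → ∀ T : ℝ, 0 < T → ∀ u : ℝ → L2C, 𝒜.IsMildSolution (schwartzL2 u₀) (Ico 0 T) u → (∃ C : ℝ, ∀ t ∈ Ico 0 T, eFourierSobolevNorm 10 (u t) ≤ ENNReal.ofReal C) → ∃ T' : ℝ, T < T' ∧ ∃ v : ℝ → L2C, 𝒜.IsMildSolution (schwartzL2 u₀) (Ico 0 T') v ∧ ∀ t ∈ Ico 0 T, v t = u t := by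
  intro 𝒜 u₀ _ T hT u hu hbd
  obtain ⟨C, hC⟩ := hbd
  exact Floor.extends_of_H10_bounded 𝒜 hT hu hC

/-- **THE ABSTRACT LERAY FLOOR IN THE BESOV ENVELOPE** (idea card `besov-envelope-floor`, K3; the
planner's `AbstractLerayFloor`), for EVERY averaging datum `𝒜` (no symmetry, no cancellation): there is
`ε = ε(𝒜) > 0` such that every `H¹⁰_df`-mild solution `u` on `[0,T)` from a Schwartz divergence-free
datum whose envelope amplitude `√(T-t₀) ‖u(t₀)‖_{Ḃ⁰_{∞,1}}` is `≤ ε` at ONE time `t₀ ∈ [0,T)` extends as a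
mild solution past `T`. Proof: bootstrap of the envelope from `t₀` (`stub_besovDuhamelBound`), `H¹⁰`
persistence (`stub_tameDuhamelBound`), reduction (`stub_besovFloorBound_Reduction`), continuation
criterion. This is Leray's 1934 lower bound on the blow-up rate, abstractly and per datum, at the
`L^∞`-scaling tier where the averaged class has no `L^∞` theory (Tao 2016, p. 7 footnote). -/
theorem stub_thesis_AbstractLerayFloor : ∀ 𝒜 : AveragingDatum, ∃ ε : ℝ, 0 < ε ∧ ∀ u₀ : 𝓢(EuclideanSpace ℝ (Fin 3), EuclideanSpace ℝ (Fin 3)), VectorCalculus.IsDivFree ⇑u₀ → ∀ T : ℝ, 0 < T → ∀ u : ℝ → L2C, 𝒜.IsMildSolution (schwartzL2 u₀) (Ico 0 T) u → (∃ t₀ ∈ Ico 0 T, ENNReal.ofReal (Real.sqrt (T - t₀)) * eHomBesovNorm 0 ⊤ 1 ((u t₀ : L2C) : 𝓢'(EuclideanSpace ℝ (Fin 3), EuclideanSpace ℂ (Fin 3))) ≤ ENNReal.ofReal ε) → ∃ T' : ℝ, T < T' ∧ ∃ v : ℝ → L2C, 𝒜.IsMildSolution (schwartzL2 u₀) (Ico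 0 T') v ∧ ∀ t ∈ Ico 0 T, v t = u t := by
  intro 𝒜
  obtain ⟨ε, hε, hfloor⟩ := stub_besovFloorBound_Reduction 𝒜 (stub_besovDuhamelBound 𝒜)
    (stub_tameDuhamelBound 𝒜)
  refine ⟨ε, hε, fun u₀ hdiv T hT u hu hdip => ?_⟩
  exact stub_thesis_H10Continuation 𝒜 u₀ hdiv T hT u hu (hfloor u₀ hdiv T hT u hu hdip)

/-- **Leray's lower bound on the blow-up rate, abstractly, in the envelope** (corollary of the floor):
for every averaging datum there is `ε(𝒜) > 0` such that an `H¹⁰_df`-mild solution on `[0,T)` from a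
Schwartz divergence-free datum with NO mild extension past `T` satisfies
`√(T-t) ‖u(t)‖_{Ḃ⁰_{∞,1}} > ε` at EVERY time `t ∈ [0,T)` (Leray 1934 §20 proves
`‖u(t)‖_∞ ≥ c√ν (T-t)^{-1/2}` for Navier–Stokes; here the class has no `L^∞` theory and the envelope
`Ḃ⁰_{∞,1} ⊃ H¹⁰` replaces `L^∞`). In particular the constant `M'` of a persistent front (stub K1,
`NoPersistentFront`) is bounded BELOW by `ε(𝒜)`: only the large-constant regime of K1 is open. -/
theorem stub_thesis_LerayFloorRate : ∀ 𝒜 : AveragingDatum, ∃ ε : ℝ, 0 < ε ∧ ∀ u₀ : 𝓢(EuclideanSpace ℝ (Fin 3), EuclideanSpace ℝ (Fin 3)), VectorCalculus.IsDivFree ⇑u₀ → ∀ T : ℝ, 0 < T → ∀ u : ℝ → L2C, 𝒜.IsMildSolution (schwartzL2 u₀) (Ico 0 T) u → (¬ ∃ T' : ℝ, T < T' ∧ ∃ v : ℝ → L2C, 𝒜.IsMildSolution (schwartzL2 u₀) (Ico 0 T') v ∧ ∀ t ∈ Ico 0 T, v t = u t) → ∀ t ∈ Ico 0 T, ENNReal.ofReal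 ε < ENNReal.ofReal (Real.sqrt (T - t)) * eHomBesovNorm 0 ⊤ 1 ((u t : L2C) : 𝓢'(EuclideanSpace ℝ (Fin 3), EuclideanSpace ℂ (Fin 3))) := by
  intro 𝒜
  obtain ⟨ε, hε, hfloor⟩ := stub_thesis_AbstractLerayFloor 𝒜
  refine ⟨ε, hε, fun u₀ hdiv T hT u hu hno t ht => ?_⟩
  by_contra hle
  exact hno (hfloor u₀ hdiv T hT u hu ⟨t, ht, not_lt.mp hle⟩)

end Summit.NavierStokesRegularity.NavierStokesRegularity.Theorems.PerpetualPumpThesis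

end
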